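import Literature.NumberTheory.Automorphic.AdelicGroupDataCompactMeasure
import Literature.NumberTheory.Automorphic.AdelicUnitaryGroupDatum
import Literature.NumberTheory.Automorphic.LevelOrbitPushforward
import Literature.MeasureTheory.Group.UnimodularOfCocompact
import HarnessLib

/-!
# Automorphic measures for anisotropic groups: the unitary group of a CM field

Topic `NumberTheory/Automorphic`; namespace `Literature.NumberTheory.Automorphic` (grouping
sub-namespaces `AdelicGroupData`, `UnitaryGroup`). Proof file: theorems only, no definition, no named
fact, no `sorry`; imports = tree + Mathlib.

The tree constructs automorphic measures (`AdelicGroupData.IsAutomorphicMeasure`: finite, positive on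
non-empty open sets, inner regular, `G(𝔸_K)`-invariant Borel measures on the automorphic quotient
`G(𝔸_K) ⧸ (A_G · G(K))`) on COMPACT automorphic quotients from a central retraction `θ` onto `A_G` and
the hypothesis that the modular function of `G(𝔸_K)¹ = ker θ` is trivial on `G(K)`
(`AdelicGroupData.exists_isAutomorphicMeasure_of_compactSpace`, `AdelicGroupDataCompactMeasure`;
instances: `GL₁` in `AdelicGroupDataGLOneMeasureProofs`, quaternion units in
`QuaternionAlgebraAdelicMeasureProofs`). This file adds the case **`A_G = 1`** (anisotropic centre),
where NO modular hypothesis is needed: `G(K)` is then a discrete COCOMPACT subgroup of `G(𝔸_K)`, so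
`G(𝔸_K)` is unimodular (a group with a uniform lattice is unimodular — tree
`LevelOrbit.isMulRightInvariant_of_compactSpace_quotient`, `LevelOrbitPushforward`, after Raghunathan (1972) Ch. I
Rem. 1.9) and its modular function is identically `1`
(`Literature.MeasureTheory.Group.modularCharacter_eq_one_of_compactSpace_quotient`,
`UnimodularOfCocompact`):

* `AdelicGroupData.exists_isAutomorphicMeasure_of_center'_eq_bot` — for an adelic group datum with
  `A_G = ⊥`, `G(K)` discrete in a locally compact second countable Hausdorff `G(𝔸_K)`, and compact
  automorphic quotient, an automorphic measure exists (Borel (1963) §5: the finite invariant measure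
  on `G_A / G_k` for `k`-anisotropic `G`);
* `UnitaryGroup.exists_isAutomorphicMeasure_cmDatum` — **the unitary group `U(H)` of an ANISOTROPIC
  hermitian matrix `H ∈ M_N(L)` over a CM field `L`** (datum `UnitaryGroup.cmDatum L N H` of
  `AdelicUnitaryGroupDatum`: `Adelic = adelicUnitaryGroup L H`, `A_G = ⊥`, compact automorphic quotient
  by the tree's Godement criterion `compactSpace_cmDatum_automorphicQuotient`) carries an automorphic
  measure on `U(H)(𝔸_{L⁺}) ⧸ U(H)(L⁺)`; `…_of_posDef` — the Picard-modular regime (`H` definite at one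
  complex place); `…_adelicGroupData[_of_posDef]` — the same for the tree's generic datum
  `UnitaryGroup.adelicGroupData L⁺ L c N H` (definitionally `cmDatum`, `adelicGroupData_eq_cmDatum`).

These discharge the `(μ) [IsAutomorphicMeasure μ]` binders of the `AdelicGroupData`-level automorphic
API (`AutomorphicSpectrumCompactQuotient`, the right-regular representation on `L²` of the quotient)
for compact unitary quotients.

## References

* A. Borel, *Some finiteness properties of adele groups over number fields*, Publ. Math. IHÉS 16
  (1963), §5 (Thm. 5.8: `G_A/G_k` compact with finite invariant measure for `k`-anisotropic
  reductive `G`). [Borel1963]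
* R. Godement, *Domaines fondamentaux des groupes arithmétiques*, Sém. Bourbaki 257 (1962/63), §5
  Thm. 4. [Godement1964]
* M. S. Raghunathan, *Discrete subgroups of Lie groups* (1972), Ch. I, Remark 1.9. [folklore]
-/

noncomputable section

open MeasureTheory Measure Topology NumberField
open scoped NNReal ComplexOrder

namespace Literature.NumberTheory.Automorphic

namespace AdelicGroupData

universe u

variable {K : Type} [Field K] [NumberField K]

/-- **Automorphic measure for a datum with trivial split centre and compact automorphic quotient.**
If `A_G = ⊥`, `G(K)` is discrete in the locally compact second countable Hausdorff group `G(𝔸_K)` and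
`G(𝔸_K) ⧸ G(K)` is compact, then the automorphic quotient carries an automorphic measure. Proof:
`exists_isAutomorphicMeasure_of_compactSpace` with the trivial retraction `θ = 1` (`ker θ = G(𝔸_K)`);
its modular hypothesis holds because `G(K)` is a discrete cocompact subgroup of `ker θ`, whence
`ker θ` is unimodular (`LevelOrbit.isMulRightInvariant_of_compactSpace_quotient`) and its modular function is `1`
(`Literature.MeasureTheory.Group.modularCharacter_eq_one_of_compactSpace_quotient`).
[cite: Borel1963, §5] -/
theorem exists_isAutomorphicMeasure_of_center'_eq_bot (𝒢 : AdelicGroupData.{u} K)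
    [LocallyCompactSpace 𝒢.Adelic] [SecondCountableTopology 𝒢.Adelic] [T2Space 𝒢.Adelic]
    (hdisc : 𝒢.IsDiscreteRational) (hc : 𝒢.center' = ⊥) [CompactSpace 𝒢.automorphicQuotient] :
    ∃ μ : Measure 𝒢.automorphicQuotient, 𝒢.IsAutomorphicMeasure μ := by
  classical
  -- the trivial retraction
  set θ : 𝒢.Adelic →* 𝒢.Adelic := 1 with hθ
  have hθ1 : ∀ g, θ g = 1 := fun g => rfl
  have hθc : Continuous θ := by
    show Continuous fun _ : 𝒢.Adelic => θ _
    simp only [hθ1]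
    exact continuous_const
  have hθA : ∀ g, θ g ∈ 𝒢.center' := fun g => by
    rw [hθ1]
    exact one_mem _
  have hθa : ∀ a ∈ 𝒢.center', θ a = a := fun a ha => by
    rw [hc, Subgroup.mem_bot] at ha
    rw [ha, hθ1]
  have hθγ : ∀ γ ∈ 𝒢.arithmeticSubgroup, θ γ = 1 := fun γ _ => hθ1 γ
  -- `ker θ = G(𝔸_K)` is closed, hence locally compact and second countable
  have hker : IsClosed ((θ.ker : Subgroup 𝒢.Adelic) : Set 𝒢.Adelic) := by
    have : ((θ.ker : Subgroup 𝒢.Adelic) : Set 𝒢.Adelic) = Set.univ := by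
      ext g
      simp only [SetLike.mem_coe, MonoidHom.mem_ker, hθ1, Set.mem_univ]
    rw [this]
    exact isClosed_univ
  haveI hlc : LocallyCompactSpace θ.ker := hker.isClosedEmbedding_subtypeVal.locallyCompactSpace
  haveI : SecondCountableTopology θ.ker := TopologicalSpace.Subtype.secondCountableTopology _
  -- `G(K)` as a discrete cocompact subgroup of `ker θ`
  have hmemΓ₁ : ∀ x : θ.ker, x ∈ 𝒢.arithmeticSubgroup.subgroupOf θ.ker ↔
      (x : 𝒢.Adelic) ∈ 𝒢.arithmeticSubgroup := fun x => Subgroup.mem_subgroupOf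
  haveI : DiscreteTopology 𝒢.arithmeticSubgroup := hdisc
  haveI : DiscreteTopology (𝒢.arithmeticSubgroup.subgroupOf θ.ker) := by
    refine DiscreteTopology.of_continuous_injective
      (f := fun x : 𝒢.arithmeticSubgroup.subgroupOf θ.ker =>
        (⟨(x : θ.ker), (hmemΓ₁ x).1 x.2⟩ : 𝒢.arithmeticSubgroup)) ?_ ?_
    · exact (continuous_subtype_val.comp continuous_subtype_val).subtype_mk _
    · intro a b hab
      have h : ((a : θ.ker) : 𝒢.Adelic) = ((b : θ.ker) : 𝒢.Adelic) :=
        congrArg (fun y : 𝒢.arithmeticSubgroup => (y : 𝒢.Adelic)) hab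
      exact Subtype.ext (Subtype.ext h)
  obtain ⟨-, e, -⟩ := exists_retraction_homeomorph 𝒢 θ hθc hθA hθa hθγ
  haveI : CompactSpace (θ.ker ⧸ 𝒢.arithmeticSubgroup.subgroupOf θ.ker) := e.symm.compactSpace
  -- hence the modular function of `ker θ` is trivial
  have hmod : ∀ γ (hγ : γ ∈ 𝒢.arithmeticSubgroup),
      modularCharacter (⟨γ, (MonoidHom.mem_ker).2 (hθγ γ hγ)⟩ : θ.ker) = 1 := by
    intro γ hγ
    letI : MeasurableSpace θ.ker := borel _
    haveI : BorelSpace θ.ker := ⟨rfl⟩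
    haveI : (haar : Measure θ.ker).IsMulRightInvariant :=
      LevelOrbit.isMulRightInvariant_of_compactSpace_quotient
        (𝒢.arithmeticSubgroup.subgroupOf θ.ker) haar
    exact Literature.MeasureTheory.Group.modularCharacter_eq_one_of_compactSpace_quotient
      (𝒢.arithmeticSubgroup.subgroupOf θ.ker) (haar : Measure θ.ker)
      (fun h _ => map_mul_right_eq_self haar h) _
  exact exists_isAutomorphicMeasure_of_compactSpace 𝒢 hdisc θ hθc hθA hθa hθγ hlc hmod

end AdelicGroupData

/-! ### The unitary group of an anisotropic hermitian matrix over a CM field -/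

namespace UnitaryGroup

open Literature.AlgebraicGeometry.ShimuraVarieties (hermForm)

variable (L : Type) [Field L] [NumberField L] [IsCMField L] (N : ℕ) (H : Matrix (Fin N) (Fin N) L)

/-- **Automorphic measure on `U(H)(𝔸_{L⁺}) ⧸ U(H)(L⁺)` for an anisotropic hermitian matrix `H` over a
CM field `L`.** The datum `cmDatum L N H` has `A_G = ⊥` (`cmDatum_center'`), discrete rational points
(`cmDatum_isDiscreteRational`) and, `H` being anisotropic, compact automorphic quotient
(`compactSpace_cmDatum_automorphicQuotient`, Godement's criterion); apply
`AdelicGroupData.exists_isAutomorphicMeasure_of_center'_eq_bot`. Borel (1963) §5 (finite invariant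
measure on `G_A/G_k`, `G` anisotropic over `k`); Godement, Sém. Bourbaki 257 §5 Thm. 4.
[cite: Borel1963, §5] [cite: Godement1964, §5 Theorem 4] -/
theorem exists_isAutomorphicMeasure_cmDatum
    (hanis : ∀ x : Fin N → L, hermForm (cmConjRingHom L) H x x = 0 → x = 0) :
    ∃ μ : Measure (cmDatum L N H).automorphicQuotient, (cmDatum L N H).IsAutomorphicMeasure μ := by
  haveI := compactSpace_cmDatum_automorphicQuotient L N H hanis
  exact AdelicGroupData.exists_isAutomorphicMeasure_of_center'_eq_bot (cmDatum L N H)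
    (cmDatum_isDiscreteRational L N H) (cmDatum_center' L N H)

/-- **Automorphic measure for `U(H)`, `H` positive definite at one complex embedding** (then `H` is
anisotropic, `anisotropic_of_posDef_map`; the Picard-modular regime: signature `(2,1)` at one place,
definite at another). [cite: Borel1963, §5] -/
theorem exists_isAutomorphicMeasure_cmDatum_of_posDef (τ : L →+* ℂ) (hτ : (H.map τ).PosDef) :
    ∃ μ : Measure (cmDatum L N H).automorphicQuotient, (cmDatum L N H).IsAutomorphicMeasure μ :=
  exists_isAutomorphicMeasure_cmDatum L N H (anisotropic_of_posDef_map L H τ hτ)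

/-- **Automorphic measure for the tree's generic unitary datum** `UnitaryGroup.adelicGroupData L⁺ L c N H`
at the CM pair `(L⁺, L, complex conjugation)`, `H` anisotropic (the generic datum is definitionally
`cmDatum L N H`, `adelicGroupData_eq_cmDatum`). [cite: Borel1963, §5] -/
theorem exists_isAutomorphicMeasure_adelicGroupData
    (hanis : ∀ x : Fin N → L, hermForm (cmConjRingHom L) H x x = 0 → x = 0) :
    ∃ μ : Measure
        (adelicGroupData ↥(maximalRealSubfield L) L (IsCMField.complexConj L) N H).automorphicQuotient,
      (adelicGroupData ↥(maximalRealSubfield L) L (IsCMField.complexConj L) N H).IsAutomorphicMeasure μ :=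
  exists_isAutomorphicMeasure_cmDatum L N H hanis

/-- **Automorphic measure for the tree's generic unitary datum, `H` definite at one complex place.**
[cite: Borel1963, §5] -/
theorem exists_isAutomorphicMeasure_adelicGroupData_of_posDef (τ : L →+* ℂ) (hτ : (H.map τ).PosDef) :
    ∃ μ : Measure
        (adelicGroupData ↥(maximalRealSubfield L) L (IsCMField.complexConj L) N H).automorphicQuotient,
      (adelicGroupData ↥(maximalRealSubfield L) L (IsCMField.complexConj L) N H).IsAutomorphicMeasure μ :=
  exists_isAutomorphicMeasure_cmDatum_of_posDef L N H τ hτ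

end UnitaryGroup

end Literature.NumberTheory.Automorphic

end
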